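import Summits.KontsevichZagierPeriods.KontsevichZagierPeriods.Theorems.HermiteRigidityReductionRigidityOfKernelForm

/-!
# KontsevichZagierPeriods / HermiteRigidity — `ReductionRigidityOfIslands` (stmt-KontsevichZagierPeriods-15957)

Route `KontsevichZagierPeriods/HermiteRigidity`, support item stmt-KontsevichZagierPeriods-15957
(`ReductionRigidityOfIslands`, rank 9), the SPLIT GLUE of the route's rank-0 target
`ReductionRigidity` (crux-strategist decomposition of stmt-KontsevichZagierPeriods-3407):

  `PadeBoxIslands → IslandComplement → ReductionRigidity`.

Here `PadeBoxIslands = I₁ ∧ I₂` is the kernel form of Conjecture 1 on the line islands (`I₁`,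
unconditional) and on the `(2, 1/N)` box islands (`I₂`, modulo the inlined `ℚ`-rigidity of
`1, Li₁(1/N), Li₂(1/N)`), and `IslandComplement = I₁ → I₂ → (∀ c, KZ.eval c = 0 → c ∈ KZ.relations)`
is the lead's remainder stub verbatim. So the two hypotheses give the kernel form of Conjecture 1 by
modus ponens, and the landed glue `reductionRigidityOfKernelForm_proof` (stmt-KontsevichZagierPeriods-14406,
`Theorems/HermiteRigidityReductionRigidityOfKernelForm.lean`) turns the kernel form into
REDUCTION + RIGIDITY. A pure chain of route declarations (no analysis).
-- adapted from Cruxes/ReductionRigidity/Split.lean (`ReductionRigidity_of_subs`, planner-cstrat-stmt-KontsevichZagierPeriods-3407-d1-0)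

References: M. Kontsevich, D. Zagier, *Periods* (2001), §1.2; A. Huber, S. Müller-Stach,
*Periods and Nori Motives* (2017), §13.1.
-/

namespace Summit.KontsevichZagierPeriods.HermiteRigidity.ReductionRigidityOfIslands

/-- **`ReductionRigidityOfIslands`** (item stmt-KontsevichZagierPeriods-15957 of route HermiteRigidity):
`PadeBoxIslands → IslandComplement → ReductionRigidity`. The islands `hI = ⟨I₁, I₂⟩` feed the island
complement `hC : I₁ → I₂ → kernel form`, and `reductionRigidityOfKernelForm_proof`
(stmt-KontsevichZagierPeriods-14406) turns the kernel form of Conjecture 1 into `ReductionRigidity`.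
[Kontsevich–Zagier 2001, §1.2] [folklore] -/
theorem reductionRigidityOfIslands_proof :
    Summit.KontsevichZagierPeriods.KontsevichZagierPeriods.Theses.HermiteRigidity.ReductionRigidityOfIslands := by
  unfold Summit.KontsevichZagierPeriods.KontsevichZagierPeriods.Theses.HermiteRigidity.ReductionRigidityOfIslands
  intro hI hC
  exact Summit.KontsevichZagierPeriods.HermiteRigidity.ReductionRigidityOfKernelForm.reductionRigidityOfKernelForm_proof
    (hC hI.1 hI.2)

end Summit.KontsevichZagierPeriods.HermiteRigidity.ReductionRigidityOfIslands
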